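import Summits.QuantumFields.BalabanUV.T4Continuum.Support.NE7HessGaugeDir
import Summits.QuantumFields.BalabanUV.T4Continuum.Support.NE7TanCriticalGauge
import Summits.QuantumFields.BalabanUV.T4Continuum.Support.AveragingDeficitLocality
import HarnessLib

/-!
# NE7HessGaugeDirLeft — THE HESSIAN OF THE WILSON ACTION WITH A GAUGE DIRECTION IN THE FIRST SLOT: for a SPARSE generator `ξ` (no bond carries `ξ` at both ends)
# `hess V (gaugeDir V ξ) Y F = dAction V K F`, `K(x,κ) = Y(x,κ)·ξ(x+e_κ) − ξ(x+e_κ)·Y(x,κ)` — the first variation in a commutator direction; hence at a background that is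
# critical on ALL skew periodic directions the Hessian functional of a sparse gauge mode VANISHES IDENTICALLY (file 57 of the curved (APE), the first-slot twin of F107)

Cell `pub-balaban`, rung (B)+1 sub-cell t4, lineage `b2b-balaban-t4-ne7-p1` (CRUX PROVER NE7 #1 = OWNER of row NE7), generation 80; memo
`t4/b2b-balaban-t4-ne7-p1-g80/SLICE-LETTER-OBSTRUCTION.md` §1.  File F127, over F107 `NE7HessGaugeDir` (`hasDerivAt_gaugeShift`), `NE3HessForm.hasDerivAt_dAction_vary`
(`d/dt|₀ dAction (Ve^{tX}) Y = hess V X Y`), F39 `NE7TanCriticalGauge.dAction_gaugeAct` (gauge covariance of the first variation), `AveragingDeficitLocality.expUnit_Ad`.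
WHY.  F107 put the gauge direction in the SECOND slot of the tree's ordered mixed Hessian `hess V X Y F = ∂_s∂_t|₀ A_F((Ve^{sX})e^{tY})`.  The slice-solver letter (L2) of the
curved (APE) (`hG` of F55 … F123d) bounds `curl_W X` by the functional `Y ↦ hess W X Y` on the slice — the candidate `X` sits in the FIRST slot.  For a gauge mode
`X = gaugeDir V ξ` the curve `t ↦ Ve^{tX}` is NOT the gauge orbit `t ↦ V^{e^{tξ}}` in general (the two agree to first order only), but for a SPARSE generator — at every
bond `⟨x, x+e_κ⟩` one of `ξ(x)`, `ξ(x+e_κ)` vanishes — the two curves COINCIDE EXACTLY (`e^{tA}e^{−tB} = e^{t(A−B)}` when one of `A`, `B` is `0`), so the first-slot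
Hessian is the `t`-derivative of `dAction (V^{e^{tξ}}) Y = dAction V (Ad_{e^{−tξ(x+e_κ)}}Y)` (gauge covariance), i.e. the first variation in the direction
`d/dt|₀ e^{−tξ⁺}Ye^{tξ⁺} = Yξ⁺ − ξ⁺Y`.  Periodised single-site bumps are sparse (period `≥ 2`); they are the witnesses of the successor file F128
`NE7SliceLetterGaugeObstruction` (the letter (L2) as typed is unsatisfiable at every globally critical background with a non-commuting plaquette).
WHAT ([folklore]; 0 def, 0 sorry).  §1 `gaugeAct_expGauge_eq_vary_of_sparse`; §2 `hasDerivAt_dAction_dir` (the first variation along a bondwise-differentiable family of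
directions), `hasDerivAt_dAction_undress`; §3 **`hess_gaugeDir_left_of_sparse`**, `hess_gaugeDir_left_eq_zero_of_critical` (at a background critical on every skew
`P`-periodic direction, for sparse skew `P`-periodic `ξ` and skew `P`-periodic `Y`: `hess V (gaugeDir V ξ) Y (perWin d P) = 0`); §4 `abs_hess_gaugeDir_left_le`
(`|hess V (gaugeDir V ξ) Y F| ≤ a·Σ_{p∈F}‖curl_V K(p)‖` for `SmallField V a`), `norm_commDir_le` (`‖K‖ ≤ 2‖ξ⁺‖‖Y‖`).
HONEST FRAMING (page 1): exact matrix calculus at one configuration; nothing of Bałaban's asserted; (APE) NOT proved; NOT ONE-STEP, NOT NE7; spine 0∕9; finite T⁴ rung (B)+1 —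
NOT infinite volume, NOT mass gap, NOT `BetaPertH`, NOT Clay.  Continuum YM on T⁴ ⇐ BetaPertH ∧ nine spine estimates (0/9 proved); BetaPertH ⇐ (D1) ∧ (D4) ∧ CAP+tail;
G-an2-4 gates asym, D1 and NE2/3/4.
-/

set_option autoImplicit false

open scoped BigOperators Matrix.Norms.L2Operator
open NormedSpace Finset

namespace Summit.QuantumFields.BalabanUV.T4Continuum.NE7HessGaugeDirLeft

open Literature.MathematicalPhysics.QuantumFieldTheory.Balaban1983to89
open B7Prop1Explicit B7Prop2Explicit UnitaryModel
open T4AveragingDeficitWall hiding Site Plane Plaq Bond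
open AveragingDeficitPeriodicCounting (IsPeriodicDir)
open MinimalActionLevels (perWin)
open BlockAveragePushDirGauge (gaugeDir expGauge)
open NE3HessForm (hess hessPlaq dAction hasDerivAt_dAction_vary)
open NE7HessGaugeDir (hasDerivAt_gaugeShift)
open NE7TanCriticalGauge (dAction_gaugeAct dress_undress)
open NE7OneStepLetters (abs_dAction_le_radius_mul)
open AveragingDeficitNearIdentity (Ad_one Ad_zero)
open AveragingDeficitNearIdentity (Ad_smul)
open AveragingDeficitLocality (expUnit_Ad)
open AveragingDeficitTransport (Ad_mem_skewAdjoint)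
open NE3ProductPath (commutator_mem_skewAdjoint)

noncomputable section

variable {d : ℕ} {n : Type*} [Fintype n] [DecidableEq n]

/-! ## §1 Sparse generators: the exponential gauge orbit IS the bondwise variation -/

/-- **FOR A SPARSE GENERATOR THE GAUGE ORBIT IS A BONDWISE VARIATION, EXACTLY**: if at every bond one of `ξ(x)`, `ξ(x+e_κ)` vanishes, then
`V^{e^{tξ}} = V·e^{t·gaugeDir V ξ}` for every `t`. [folklore] -/
theorem gaugeAct_expGauge_eq_vary_of_sparse (V : Site d → Fin d → (Matrix n n ℂ)ˣ) (ξ : Site d → Matrix n n ℂ)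
    (hξ : ∀ (x : Site d) (κ : Fin d), ξ x = 0 ∨ ξ (x + e κ) = 0) (t : ℝ) :
    gaugeAct (expGauge ξ t) V = vary V (gaugeDir V ξ) t := by
  funext x κ
  rcases hξ x κ with h | h
  · -- `ξ(x) = 0`: both sides are `V(b)·e^{−tξ(x+e_κ)}`
    simp only [gaugeAct, expGauge, vary, gaugeDir, h, smul_zero, expUnit_zero, one_mul, Ad_zero, zero_sub, smul_neg,
      val_inv_expUnit]
  · -- `ξ(x+e_κ) = 0`: both sides are `e^{tξ(x)}·V(b)`
    simp only [gaugeAct, expGauge, vary, gaugeDir, h, smul_zero, expUnit_zero, inv_one, mul_one, sub_zero]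
    rw [← Ad_smul, expUnit_Ad]
    simp only [← mul_assoc, mul_inv_cancel, one_mul, inv_inv]

/-! ## §2 The first variation along a differentiable family of directions -/

/-- One transported bond value: `t ↦ Ad_u (ψ_t(b))` has derivative `Ad_u (ψ′(b))`. [folklore] -/
theorem hasDerivAt_Ad_dir (u : (Matrix n n ℂ)ˣ) {f : ℝ → Matrix n n ℂ} {f' : Matrix n n ℂ} (hf : HasDerivAt f f' 0) :
    HasDerivAt (fun t : ℝ => Ad u (f t)) (Ad u f') 0 := by
  have h := (hf.const_mul ((u : (Matrix n n ℂ)ˣ) : Matrix n n ℂ)).mul_const (((u⁻¹ : (Matrix n n ℂ)ˣ) : Matrix n n ℂ))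
  refine h.congr_of_eventuallyEq (Filter.Eventually.of_forall fun t => ?_)
  simp only [Ad]

/-- **THE FIRST VARIATION ALONG A BONDWISE-DIFFERENTIABLE FAMILY OF DIRECTIONS**: if `t ↦ ψ_t(b)` has derivative `ψ′(b)` at `0` for every bond, then
`t ↦ dAction V ψ_t F` has derivative `dAction V ψ′ F` at `0` (`dAction` is linear in the direction and sees finitely many bonds). [folklore] -/
theorem hasDerivAt_dAction_dir (V : Site d → Fin d → (Matrix n n ℂ)ˣ) {ψ : ℝ → Site d → Fin d → Matrix n n ℂ} {ψ' : Site d → Fin d → Matrix n n ℂ}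
    (hψ : ∀ (x : Site d) (κ : Fin d), HasDerivAt (fun t : ℝ => ψ t x κ) (ψ' x κ) 0) (F : Finset (T4AveragingDeficitWall.Plaq d)) :
    HasDerivAt (fun t : ℝ => dAction V (ψ t) F) (dAction V ψ' F) 0 := by
  -- one plaquette: the dressed curl is a transported linear combination of four bond values
  have hcurl : ∀ (z : Site d) (μ ν : Fin d),
      HasDerivAt (fun t : ℝ => curlAt V (ψ t) z μ ν) (curlAt V ψ' z μ ν) 0 := by
    intro z μ ν
    have h₁ := hasDerivAt_Ad_dir (V z μ) (hψ z μ)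
    have h₂ := hasDerivAt_Ad_dir (V z μ * V (z + e μ) ν) (hψ (z + e μ) ν)
    have h₃ := hasDerivAt_Ad_dir (V z μ * V (z + e μ) ν) (hψ (z + e ν) μ)
    have h₄ := hasDerivAt_Ad_dir (V z μ * V (z + e μ) ν * (V (z + e ν) μ)⁻¹) (hψ z ν)
    have H := ((h₁.add h₂).sub h₃).sub h₄
    refine H.congr_of_eventuallyEq (Filter.Eventually.of_forall fun t => ?_)
    simp only [Pi.add_apply, Pi.sub_apply, curlAt]
  have hplaq : ∀ p : T4AveragingDeficitWall.Plaq d,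
      HasDerivAt (fun t : ℝ => -nReTr (curl V (ψ t) p * ((fhol V p : (Matrix n n ℂ)ˣ) : Matrix n n ℂ)))
        (-nReTr (curl V ψ' p * ((fhol V p : (Matrix n n ℂ)ˣ) : Matrix n n ℂ))) 0 := by
    intro p
    have h := (hcurl p.1 p.2.1.1 p.2.1.2).mul_const (((fhol V p : (Matrix n n ℂ)ˣ) : Matrix n n ℂ))
    have h2 := ((nReTrL (n := n)).hasFDerivAt.comp_hasDerivAt (0 : ℝ) h).neg
    refine (h2.congr_of_eventuallyEq (Filter.Eventually.of_forall fun t => ?_)).congr_deriv ?_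
    · simp only [Pi.neg_apply, Function.comp_apply, nReTrL_apply, curl]
    · simp only [nReTrL_apply, curl]
  have hsum := HasDerivAt.sum (u := F) (x := (0 : ℝ))
    (A := fun p t => -nReTr (curl V (ψ t) p * ((fhol V p : (Matrix n n ℂ)ˣ) : Matrix n n ℂ)))
    (A' := fun p => -nReTr (curl V ψ' p * ((fhol V p : (Matrix n n ℂ)ˣ) : Matrix n n ℂ))) fun p _ => hplaq p
  have hsum' : HasDerivAt (fun t : ℝ => ∑ p ∈ F, -nReTr (curl V (ψ t) p * ((fhol V p : (Matrix n n ℂ)ˣ) : Matrix n n ℂ)))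
      (∑ p ∈ F, -nReTr (curl V ψ' p * ((fhol V p : (Matrix n n ℂ)ˣ) : Matrix n n ℂ))) 0 := by
    simpa [Finset.sum_fn] using hsum
  refine (hsum'.congr_of_eventuallyEq (Filter.Eventually.of_forall fun t => ?_)).congr_deriv ?_
  · simp only [dAction, Finset.sum_neg_distrib]
  · simp only [dAction, Finset.sum_neg_distrib]

/-- The undressed direction `t ↦ Ad_{e^{−tξ(x+e_κ)}} Y(x,κ)` has derivative `Y(x,κ)·ξ(x+e_κ) − ξ(x+e_κ)·Y(x,κ)` at `0` (F107's gauge shift at the unit `1`). [folklore] -/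
theorem hasDerivAt_undress (ξ : Site d → Matrix n n ℂ) (Y : Site d → Fin d → Matrix n n ℂ) (x : Site d) (κ : Fin d) :
    HasDerivAt (fun t : ℝ => Ad (expGauge ξ t (x + e κ))⁻¹ (Y x κ)) (Y x κ * ξ (x + e κ) - ξ (x + e κ) * Y x κ) 0 := by
  have h := hasDerivAt_gaugeShift (1 : (Matrix n n ℂ)ˣ) (ξ (x + e κ)) (Y x κ)
  simp only [inv_one, Ad_one, one_mul] at h
  have h' := h.add_const (Y x κ)
  refine h'.congr_of_eventuallyEq (Filter.Eventually.of_forall fun t => ?_)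
  simp only [expGauge, sub_add_cancel]

/-- **THE FIRST VARIATION ALONG THE UNDRESSED DIRECTION**: `d/dt|₀ dAction V (Ad_{e^{−tξ⁺}}Y) F = dAction V (Yξ⁺ − ξ⁺Y) F`, `ξ⁺(x,κ) = ξ(x+e_κ)`. [folklore] -/
theorem hasDerivAt_dAction_undress (V : Site d → Fin d → (Matrix n n ℂ)ˣ) (ξ : Site d → Matrix n n ℂ) (Y : Site d → Fin d → Matrix n n ℂ)
    (F : Finset (T4AveragingDeficitWall.Plaq d)) :
    HasDerivAt (fun t : ℝ => dAction V (fun x κ => Ad (expGauge ξ t (x + e κ))⁻¹ (Y x κ)) F)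
      (dAction V (fun x κ => Y x κ * ξ (x + e κ) - ξ (x + e κ) * Y x κ) F) 0 :=
  hasDerivAt_dAction_dir V (ψ := fun t x κ => Ad (expGauge ξ t (x + e κ))⁻¹ (Y x κ)) (fun x κ => hasDerivAt_undress ξ Y x κ) F

/-! ## §3 The Hessian with a sparse gauge direction in the first slot -/

/-- **THE HESSIAN WITH A GAUGE DIRECTION IN THE FIRST SLOT** (sparse generator, every background `V`, every window `F`):
`hess V (gaugeDir V ξ) Y F = dAction V K F`, `K(x,κ) = Y(x,κ)·ξ(x+e_κ) − ξ(x+e_κ)·Y(x,κ)` — the first variation in a commutator direction. [folklore] -/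
theorem hess_gaugeDir_left_of_sparse (V : Site d → Fin d → (Matrix n n ℂ)ˣ) (ξ : Site d → Matrix n n ℂ)
    (hξ : ∀ (x : Site d) (κ : Fin d), ξ x = 0 ∨ ξ (x + e κ) = 0) (Y : Site d → Fin d → Matrix n n ℂ) (F : Finset (T4AveragingDeficitWall.Plaq d)) :
    hess V (gaugeDir V ξ) Y F = dAction V (fun x κ => Y x κ * ξ (x + e κ) - ξ (x + e κ) * Y x κ) F := by
  have h1 := hasDerivAt_dAction_vary V (gaugeDir V ξ) Y F
  have heq : (fun t : ℝ => dAction (vary V (gaugeDir V ξ) t) Y F)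
      = fun t : ℝ => dAction V (fun x κ => Ad (expGauge ξ t (x + e κ))⁻¹ (Y x κ)) F := by
    funext t
    rw [← gaugeAct_expGauge_eq_vary_of_sparse V ξ hξ t]
    have h := dAction_gaugeAct (expGauge ξ t) V (fun x κ => Ad (expGauge ξ t (x + e κ))⁻¹ (Y x κ)) F
    rw [dress_undress] at h
    exact h
  rw [heq] at h1
  exact h1.unique (hasDerivAt_dAction_undress V ξ Y F)

omit [DecidableEq n] in
/-- The commutator direction `K = Yξ⁺ − ξ⁺Y` is skew for skew data. [folklore] -/
theorem isSkewDir_commDir {ξ : Site d → Matrix n n ℂ} (hξ : ∀ x, ξ x ∈ skewAdjoint (Matrix n n ℂ)) {Y : Site d → Fin d → Matrix n n ℂ}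
    (hY : IsSkewDir Y) : IsSkewDir (fun x κ => Y x κ * ξ (x + e κ) - ξ (x + e κ) * Y x κ) :=
  fun x κ => commutator_mem_skewAdjoint (hY x κ) (hξ (x + e κ))

omit [DecidableEq n] in
/-- The commutator direction `K = Yξ⁺ − ξ⁺Y` is `P`-periodic for `P`-periodic data. [folklore] -/
theorem isPeriodicDir_commDir {ξ : Site d → Matrix n n ℂ} {P : ℤ} (hξP : ∀ (x : Site d) (i : Fin d), ξ (x + P • e i) = ξ x)
    {Y : Site d → Fin d → Matrix n n ℂ} (hYP : IsPeriodicDir Y P) :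
    IsPeriodicDir (fun x κ => Y x κ * ξ (x + e κ) - ξ (x + e κ) * Y x κ) P := by
  intro x i κ
  simp only
  rw [hYP x i κ, add_right_comm, hξP]

/-- **AT A BACKGROUND CRITICAL ON EVERY SKEW PERIODIC DIRECTION, THE HESSIAN FUNCTIONAL OF A SPARSE GAUGE MODE VANISHES IDENTICALLY**: if `dAction V Y′ (perWin d P) = 0`
for every skew `P`-periodic `Y′`, then for every sparse skew `P`-periodic generator `ξ` and every skew `P`-periodic `Y`, `hess V (gaugeDir V ξ) Y (perWin d P) = 0` —
whether or not `Y` is tangent to any slice. [folklore] -/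
theorem hess_gaugeDir_left_eq_zero_of_critical (V : Site d → Fin d → (Matrix n n ℂ)ˣ) {P : ℕ}
    (hcrit : ∀ Y' : Site d → Fin d → Matrix n n ℂ, IsSkewDir Y' → IsPeriodicDir Y' (P : ℤ) → dAction V Y' (perWin d P) = 0)
    {ξ : Site d → Matrix n n ℂ} (hξs : ∀ x, ξ x ∈ skewAdjoint (Matrix n n ℂ)) (hξP : ∀ (x : Site d) (i : Fin d), ξ (x + (P : ℤ) • e i) = ξ x)
    (hξ : ∀ (x : Site d) (κ : Fin d), ξ x = 0 ∨ ξ (x + e κ) = 0)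
    {Y : Site d → Fin d → Matrix n n ℂ} (hY : IsSkewDir Y) (hYP : IsPeriodicDir Y (P : ℤ)) :
    hess V (gaugeDir V ξ) Y (perWin d P) = 0 := by
  rw [hess_gaugeDir_left_of_sparse V ξ hξ Y]
  exact hcrit _ (isSkewDir_commDir hξs hY) (isPeriodicDir_commDir hξP hYP)

/-! ## §4 The bound: the first-slot Hessian of a gauge mode sees only the field strength -/

/-- **THE BOUND**: for unitary `V` with plaquette radius `a`, sparse skew `ξ`, skew `Y`: `|hess V (gaugeDir V ξ) Y F| ≤ a·Σ_{p∈F} ‖curl_V K(p)‖`, `K = Yξ⁺ − ξ⁺Y` — the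
commutator direction is skew, so its first variation vanishes against `1` and only `hol − 1` (`≤ a`) contributes (`NE7OneStepLetters.abs_dAction_le_radius_mul`); with
`‖K(x,κ)‖ ≤ 2‖ξ(x+e_κ)‖‖Y(x,κ)‖` (`NE3HessBounds.norm_comm_le`) this is `O(a·‖ξ‖_∞·‖Y‖_{ℓ¹})`: the Hessian functional of a gauge mode is as small as the background's
curvature, while its curl (`NE3CurlOfGaugeDir.curlAt_gaugeDir`: `ξ − Ad_{hol}ξ`) is of the SAME order — the quantitative content of F128's obstruction. [folklore] -/
theorem abs_hess_gaugeDir_left_le [Nonempty n] {V : Site d → Fin d → (Matrix n n ℂ)ˣ} (hV : IsUnitaryCfg V) {a : ℝ} (hVa : SmallField V a)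
    {ξ : Site d → Matrix n n ℂ} (hξs : ∀ x, ξ x ∈ skewAdjoint (Matrix n n ℂ)) (hξ : ∀ (x : Site d) (κ : Fin d), ξ x = 0 ∨ ξ (x + e κ) = 0)
    {Y : Site d → Fin d → Matrix n n ℂ} (hY : IsSkewDir Y) (F : Finset (T4AveragingDeficitWall.Plaq d)) :
    |hess V (gaugeDir V ξ) Y F| ≤ a * ∑ p ∈ F, ‖curl V (fun x κ => Y x κ * ξ (x + e κ) - ξ (x + e κ) * Y x κ) p‖ := by
  rw [hess_gaugeDir_left_of_sparse V ξ hξ Y F]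
  exact abs_dAction_le_radius_mul hV (isSkewDir_commDir hξs hY) hVa F

/-- The commutator direction is small with its data: `‖K(x,κ)‖ ≤ 2‖ξ(x+e_κ)‖·‖Y(x,κ)‖`. [folklore] -/
theorem norm_commDir_le (ξ : Site d → Matrix n n ℂ) (Y : Site d → Fin d → Matrix n n ℂ) (x : Site d) (κ : Fin d) :
    ‖Y x κ * ξ (x + e κ) - ξ (x + e κ) * Y x κ‖ ≤ 2 * ‖ξ (x + e κ)‖ * ‖Y x κ‖ := by
  calc ‖Y x κ * ξ (x + e κ) - ξ (x + e κ) * Y x κ‖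
      ≤ ‖Y x κ * ξ (x + e κ)‖ + ‖ξ (x + e κ) * Y x κ‖ := norm_sub_le _ _
    _ ≤ ‖Y x κ‖ * ‖ξ (x + e κ)‖ + ‖ξ (x + e κ)‖ * ‖Y x κ‖ := add_le_add (norm_mul_le _ _) (norm_mul_le _ _)
    _ = 2 * ‖ξ (x + e κ)‖ * ‖Y x κ‖ := by ring

end

end Summit.QuantumFields.BalabanUV.T4Continuum.NE7HessGaugeDirLeft
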